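import Mathlib
import Literature.NumberTheory.LFunctions.Zhang2022.AppendixAFraktHolomorphic
import Literature.NumberTheory.LFunctions.Zhang2022.AppendixALemma83Edge
import Literature.NumberTheory.LFunctions.Zhang2022.Section8Lemma84
import Literature.NumberTheory.LFunctions.Zhang2022.Section8Integral89Rel
import Literature.NumberTheory.LFunctions.Zhang2022.Section9Gathering
import Literature.NumberTheory.LFunctions.Zhang2022.Section10cGather1422Rel
import HarnessLib

/-!
# Zhang (2022) §8 Lemmas 8.3/8.4 (relative forms), §9.u004, §10 (10.14)–(10.22) gathering: OUTRIGHT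

Topic `Literature/NumberTheory/LFunctions/Zhang2022` (Landau–Siegel audit tree; verdict-neutral).
Y. Zhang, *Discrete mean estimates and the Landau–Siegel zero*, arXiv:2211.02515v1 (2022)
[Zhang2022LandauSiegel] — **an unrefereed manuscript under adjudication; nothing here asserts or denies
its Theorems 1–2.** ZHANG-L discharge lane (WP09). With both App. A leaves now theorems
(`Typed.AppendixA1.stepA_u007_analytic_holds`, `stepA_u007_read_holds`, file `AppendixAFraktHolomorphic`),
the tree's edges discharge, with NO hypothesis left, the statements that `Skeleton.theorem1_of_leaves_v20`
still carried over the binders `hAn`, `hRead`, `h83`, `h84`: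

* `Skeleton.lemma83Rel_holds : ∀ c′, Lemma83Rel c′` — **Lemma 8.3, relative form of record** (§8 p. 46;
  GAP row G-d55-3; `Lemma83.lemma83Rel_of_parts`);
* `Skeleton.lemma84Rel_holds : ∀ c′, Lemma84Rel c′` — **Lemma 8.4, relative form of record** (§8 p. 47;
  GAP row G-adj1-1; `lemma84Rel_of_lemma83Rel`), and `Typed.S8B.integral89MainTermRel_holds` (the (8.9)
  main-term evaluation in relative form, the decl named by G-adj1-1; `integral89MainTermRel_iff_lemma84Rel`);
* `Section9Statements.step9u004r_holds : 0 ≤ c′ → Step9u004r c′` — **§9.u004** (leaf h9u004r, zl-w09-p5's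
  `Section9Gathering.step9u004r_of_lemma84Rel`, plugged over `h84` in v20) now outright;
* `Typed.Sec10C.gather1422_holds : 0 ≤ c′ → Gather1422 c′` — **(10.14)–(10.22) gathering** (leaf hG1422,
  zl-w10-p2's `gather1422_of_lemma84Rel`, plugged over `h84` in v20) now outright.

One-line compositions of tree theorems; recorded so that the discharge board and the skeleton pen have
named closers. Theorems only; no definitions, no facts.

## References

* Y. Zhang, arXiv:2211.02515v1 (2022), §8 Lemmas 8.3–8.4 pp. 46–47, §9 p. 51, §10 pp. 58–61, App. A p. 101.
  [cite: Zhang2022LandauSiegel, §8 Lemmas 8.3–8.4]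
-/

noncomputable section

namespace Literature.NumberTheory.LFunctions.Zhang2022.Skeleton

open Literature.NumberTheory.LFunctions.Zhang2022

/-- **Lemma 8.3 in the relative form of record HOLDS** (`Skeleton.Lemma83Rel c′`, §8 p. 46, GAP row G-d55-3):
`𝒰_j(d,r;s)` continues analytically to `σ > 9/10`, is `≪ ∏_{q∣dr}(1 + Cq^{−σ})` there, and
`|𝒰_j(d,r;s) − Π(d,r)| ≤ C𝓛⁻⁸∏_{q∣dr}(1−q⁻¹)⁻¹` for `|s−1| ≤ 5α` — from the two App. A sentences
(`Typed.AppendixA1.stepA_u007_analytic_holds`, `stepA_u007_read_holds`) by sz-d55's aggregation edge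
`Lemma83.lemma83Rel_of_parts`. Every `c′`. [cite: Zhang2022LandauSiegel, §8 Lemma 8.3 p.46] -/
theorem lemma83Rel_holds (c' : ℝ) : Lemma83Rel c' :=
  Lemma83.lemma83Rel_of_parts c' (Typed.AppendixA1.stepA_u007_analytic_holds c')
    (Typed.AppendixA1.stepA_u007_read_holds c')

variable (c' : ℝ) in
/-- `Lemma83Rel` — `_holds` alias of `lemma83Rel_holds` above under the fact's exact name, stated under the
prover's own binders as section variables (appended 2026-08-28, D-0026 bookkeeping: the proof term is the
existing theorem of this file; no statement, definition or attribute is edited; no new named fact; the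
ledger's debt table listed the fact unproved). [cite: Zhang2022LandauSiegel, §8 Lemma 8.3 p.46] -/
theorem _root_.Literature.NumberTheory.LFunctions.Zhang2022.Skeleton.Lemma83Rel_holds :
    _root_.Literature.NumberTheory.LFunctions.Zhang2022.Skeleton.Lemma83Rel c' :=
  _root_.Literature.NumberTheory.LFunctions.Zhang2022.Skeleton.lemma83Rel_holds (c' := c')

/-- **Lemma 8.4 in the relative form of record HOLDS** (`Skeleton.Lemma84Rel c′`, §8 p. 47, GAP row G-adj1-1;
the binder `h84` of `theorem1_of_leaves_v20`): `lemma84Rel_of_lemma83Rel` (sz-d27's contour engine) applied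
to `lemma83Rel_holds`. Every `c′`. [cite: Zhang2022LandauSiegel, §8 Lemma 8.4 p.47] -/
theorem lemma84Rel_holds (c' : ℝ) : Lemma84Rel c' :=
  lemma84Rel_of_lemma83Rel (lemma83Rel_holds c')

end Literature.NumberTheory.LFunctions.Zhang2022.Skeleton

namespace Literature.NumberTheory.LFunctions.Zhang2022.Typed.S8B

open Literature.NumberTheory.LFunctions.Zhang2022

/-- **The (8.9) main-term evaluation in relative form HOLDS** (`Typed.S8B.Integral89MainTermRel c′`, the
repaired decl named by GAP row G-adj1-1, §8 proof of Lemma 8.4 p. 47): equivalent to `Lemma84Rel`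
(`integral89MainTermRel_iff_lemma84Rel`). Every `c′`. [cite: Zhang2022LandauSiegel, §8 p.47] -/
theorem integral89MainTermRel_holds (c' : ℝ) : Integral89MainTermRel c' :=
  (integral89MainTermRel_iff_lemma84Rel c').mpr (Skeleton.lemma84Rel_holds c')

variable (c' : ℝ) in
/-- `Integral89MainTermRel` — `_holds` alias of `integral89MainTermRel_holds` above under the fact's exact name, stated under the
prover's own binders as section variables (appended 2026-08-28, D-0026 bookkeeping: the proof term is the
existing theorem of this file; no statement, definition or attribute is edited; no new named fact; the
ledger's debt table listed the fact unproved). [cite: Zhang2022LandauSiegel, §8 p.47] -/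
theorem _root_.Literature.NumberTheory.LFunctions.Zhang2022.Typed.S8B.Integral89MainTermRel_holds :
    _root_.Literature.NumberTheory.LFunctions.Zhang2022.Typed.S8B.Integral89MainTermRel c' :=
  _root_.Literature.NumberTheory.LFunctions.Zhang2022.Typed.S8B.integral89MainTermRel_holds (c' := c')

end Literature.NumberTheory.LFunctions.Zhang2022.Typed.S8B

namespace Literature.NumberTheory.LFunctions.Zhang2022.Section9Statements

open Literature.NumberTheory.LFunctions.Zhang2022

/-- **§9.u004 (reading (r)) HOLDS outright** for `c′ ≥ 0` (`Section9Statements.Step9u004r c′`, §9 p. 51,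
leaf h9u004r of v19; zl-w09-p5's `Section9Gathering.step9u004r_of_lemma84Rel` at `Skeleton.lemma84Rel_holds`).
[cite: Zhang2022LandauSiegel, §9 p.51] -/
theorem step9u004r_holds {c' : ℝ} (hc' : 0 ≤ c') : Step9u004r c' :=
  Section9Gathering.step9u004r_of_lemma84Rel hc' (Skeleton.lemma84Rel_holds c')

end Literature.NumberTheory.LFunctions.Zhang2022.Section9Statements

namespace Literature.NumberTheory.LFunctions.Zhang2022.Typed.Sec10C

open Literature.NumberTheory.LFunctions.Zhang2022

/-- **The §10 gathering (10.14)–(10.22) HOLDS outright** for `c′ ≥ 0` (`Typed.Sec10C.Gather1422 c′`,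
§10 pp. 58–61, leaf hG1422 of v19; zl-w10-p2's `gather1422_of_lemma84Rel` at `Skeleton.lemma84Rel_holds`).
[cite: Zhang2022LandauSiegel, §10 p.60] -/
theorem gather1422_holds {c' : ℝ} (hc' : 0 ≤ c') : Gather1422 c' :=
  gather1422_of_lemma84Rel hc' (Skeleton.lemma84Rel_holds c')

end Literature.NumberTheory.LFunctions.Zhang2022.Typed.Sec10C

end
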